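import Literature.Computability.Complexity.CyclicPowBricks
import Literature.Computability.Complexity.CyclicListArithSpec
import Literature.Computability.Complexity.IntVectorBricks
import Literature.Computability.Complexity.IndexAllBricks
import Literature.Computability.Complexity.ListFoldChecks
import Literature.Computability.Complexity.PlumbingBricks
import Literature.Computability.Cryptography.ShorPerfectPowerFP
import HarnessLib

/-!
# The AKS primality test as one `FP` string function (Agrawal–Kayal–Saxena 2004, Thm 5.1)

Assembly, in the `FP` brick algebra of `Computability/Complexity`, of a polynomial-time decision
procedure for primality, on top of `CyclicListBricks.lean` / `CyclicPowBricks.lean` (`Brick.mulG`,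
`Brick.powG`: products and powers in `ℤ_n[X]/(X^r - 1)` on codes of highest-first coefficient lists) and
the list model `CyclicListArith(Spec).lean` (`CycList.lhs r n a`, `CycList.rhs r n a`,
`CycList.lhs_eq_rhs_iff : lhs = rhs ↔ X^r - 1 ∣ (X + a)^n - (X^n + a)`), the perfect-power detector
`ShorFP.ppF` of `Cryptography/ShorPerfectPowerFP.lean` and the bounded conjunction `Brick.allIdxFn` of
`IndexAllBricks.lean`.

Part 1 — step 5 of [AKS04, §4] for ONE pair `(r, a)`:
* `Brick.zeroListG u = pcode (CycList.zero |u|)`, `Brick.constOfG`, `Brick.linOfG` (`X + a`), `Brick.oneOf`,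
  `Brick.xpowG` (`X^m`, a counted loop of `rotF`), `Brick.rhsG` (`X^(n mod r) + a`), `Brick.lhsG`
  (`(X + a)^n` by `powG`);
* **`Brick.congrG ⟨x, ⟨p, ⟨ρ, Z⟩⟩⟩`** on the context `x = ⟨encodeNat n, u⟩`, a numeral `p` of `a`, the
  numeral `ρ = encodeNat r` and the zero list `Z = pcode (zero r)` (`2 ≤ r ≤ |x|`, `2 ≤ n`): a one-symbol
  answer with **`congrG … = [1] ↔ X^r - 1 ∣ (X + a)^n - (X^n + a)` in `(ZMod n)[X]`** (`congrG_eq_true_iff`).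

Part 2 — the whole test. `Brick.aksFn` accepts `w` iff `w = encodeNat n` and `Brick.AKSCond n`:

  `2 ≤ n`, no `d` with `2 ≤ d ≤ R`, `d < n`, `d ∣ n`, `n` is not a perfect power, and
  `X ^ r - 1 ∣ (X + a) ^ n - (X ^ n + a)` in `(ZMod n)[X]` for ALL `2 ≤ r ≤ R` and `1 ≤ a ≤ R`,

where `R = 2 K⁵ + 8`, `K = |encodeNat n| = Nat.size n` (the search bound `AKS.rBound K` of
`Literature/NumberTheory/Primality/AKSExistsR.lean`). Compared with the printed algorithm (steps 2–4:
find the LEAST `r` with `o_r(n) > log² n`, then test `a ≤ ⌊√φ(r) log n⌋`), the machine tests the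
congruences for every `r ≤ R` and every `a ≤ R`: still polynomially many tests, complete because a prime
passes every such test ([AKS04, Lemma 2.1]) and sound because the good `r ≤ R` of [AKS04, Lemma 4.3]
is among them. The equivalence `AKSCond n ↔ n.Prime` and `PRIMES ∈ P` are assembled in
`Literature/Computability/QuantumComplexity/FactoringPrimesP.lean` from the theorems of
`Literature/NumberTheory/Primality/AKS*.lean`. Main results: `congrG_eq_true_iff`, `aksFn_mem_FP`,
`aksFn_eq_true_iff`, `oneBit_aksFn`.

A parallel realisation of the same algorithm on the lowest-first convolution model `AKS.cmul` of
`AKSPolyArith.lean` is being built in `QuantumComplexity/AKSMachineArith.lean` (`AKSMachine.cmulFn`); the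
present file is independent of it.

## References

* [AKS04] M. Agrawal, N. Kayal, N. Saxena, *PRIMES is in P*, Ann. of Math. 160 (2004) 781–793, §4
  (the algorithm), §5 (Thm 5.1: polynomial running time).
* S. Arora, B. Barak, *Computational Complexity: A Modern Approach*, CUP 2009, §1.3.
-/

namespace Literature.Computability.Complexity

open _root_.Computability Polynomial Literature.Computability.Cryptography

namespace Brick


/-! ### Constant, linear and zero lists -/

/-- The iterated-pair list code of `CookReducibilityTransitive.lean` is `encList` (a local copy of
`Brick.body_eq_encList` of `GoldwasserSipserRefereeBricks.lean`, which is not imported here). [folklore] -/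
private theorem body_eq_encList' (l : List (List Bool)) : OracleCompose.body l = encList l := by
  induction l with
  | nil => rfl
  | cons a l ih => rw [OracleCompose.body_cons, encList_cons, ih]

/-- **`zeroListG u = pcode (zero |u|)`**: the zero list with `|u|` coefficients (`Brick.zerosFn`).
[folklore] -/
def zeroListG : List Bool → List Bool := zerosFn

/-- Value of `zeroListG`. [folklore] -/
@[simp] theorem zeroListG_apply (u : List Bool) : zeroListG u = pcode (CycList.zero u.length) := by
  rw [zeroListG, zerosFn_apply, body_eq_encList', pcode, CycList.zero, List.map_replicate]; rfl

/-- `zeroListG ∈ FP`. [folklore] -/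
theorem zeroListG_mem_FP : zeroListG ∈ FP := zerosFn_mem_FP

/-- `pcode` of leading zeros. [folklore] -/
theorem pcode_zero_succ (k : ℕ) : pcode (CycList.zero (k + 1)) = boolPair [] (pcode (CycList.zero k)) := by
  rw [CycList.zero, List.replicate_succ, pcode_cons]; rfl

/-- **`constOfG ⟨p, Z⟩ = pcode (zero (r-1) ++ [⟦p⟧])`** for `Z = pcode (zero r)`, `r ≥ 1`: the constant `⟦p⟧`.
[folklore] -/
noncomputable def constOfG : List Bool → List Bool := rotF ∘ fanoutFn fstF (sndF ∘ sndF)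

/-- `constOfG ∈ FP`. [folklore] -/
theorem constOfG_mem_FP : constOfG ∈ FP :=
  comp_mem_FP rotF_mem_FP (fanoutFn_mem_FP fstF_mem_FP (comp_mem_FP sndF_mem_FP sndF_mem_FP))

/-- Value of `constOfG`. [folklore] -/
theorem constOfG_apply (c : ℕ) {r : ℕ} (hr : 1 ≤ r) :
    constOfG (boolPair (encodeNat c) (pcode (CycList.zero r))) = pcode (CycList.zero (r - 1) ++ [c]) := by
  obtain ⟨k, rfl⟩ : ∃ k, r = k + 1 := ⟨r - 1, by omega⟩
  simp only [constOfG, Function.comp_apply, fanoutFn_apply, fstF_boolPair, sndF_boolPair, pcode_zero_succ,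
    Nat.add_sub_cancel]
  rw [← pcode_cons, rotF_pcode (List.cons_ne_nil _ _), CycList.rot, CycList.zero]

/-- **`linOfG ⟨p, Z⟩ = pcode (zero (r-2) ++ [1, ⟦p⟧])`** for `Z = pcode (zero r)`, `r ≥ 2`: the list of
`X + ⟦p⟧`. [cite: AgrawalKayalSaxena2004, §4 (step 5)] -/
noncomputable def linOfG : List Bool → List Bool :=
  rotF ∘ rotF ∘ fanoutFn (fun _ => [true]) (fanoutFn fstF (sndF ∘ sndF ∘ sndF))

/-- `linOfG ∈ FP`. [folklore] -/
theorem linOfG_mem_FP : linOfG ∈ FP :=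
  comp_mem_FP rotF_mem_FP (comp_mem_FP rotF_mem_FP
    (fanoutFn_mem_FP (const_mem_FP _) (fanoutFn_mem_FP fstF_mem_FP (comp_mem_FP sndF_mem_FP (comp_mem_FP sndF_mem_FP sndF_mem_FP)))))

/-- Value of `linOfG`. [folklore] -/
theorem linOfG_apply (c : ℕ) {r : ℕ} (hr : 2 ≤ r) :
    linOfG (boolPair (encodeNat c) (pcode (CycList.zero r))) = pcode (CycList.zero (r - 2) ++ [1, c]) := by
  obtain ⟨k, rfl⟩ : ∃ k, r = k + 2 := ⟨r - 2, by omega⟩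
  simp only [linOfG, Function.comp_apply, fanoutFn_apply, fstF_boolPair, sndF_boolPair, pcode_zero_succ,
    Nat.add_sub_cancel]
  rw [← encodeNat_one, ← pcode_cons, ← pcode_cons, rotF_pcode (List.cons_ne_nil _ _), CycList.rot,
    rotF_pcode (by simp), CycList.zero]
  cases k <;> simp [CycList.rot]

/-- **`oneOf Z = pcode (one r)`** for `Z = pcode (zero r)`, `r ≥ 1`. [folklore] -/
noncomputable def oneOf : List Bool → List Bool := rotF ∘ fanoutFn (fun _ => [true]) sndF

/-- `oneOf ∈ FP`. [folklore] -/
theorem oneOf_mem_FP : oneOf ∈ FP := comp_mem_FP rotF_mem_FP (fanoutFn_mem_FP (const_mem_FP _) sndF_mem_FP)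

/-- Value of `oneOf`. [folklore] -/
theorem oneOf_apply {r : ℕ} (hr : 1 ≤ r) : oneOf (pcode (CycList.zero r)) = pcode (CycList.one r) := by
  obtain ⟨k, rfl⟩ : ∃ k, r = k + 1 := ⟨r - 1, by omega⟩
  simp only [oneOf, Function.comp_apply, fanoutFn_apply, sndF_boolPair, pcode_zero_succ]
  rw [← encodeNat_one, ← pcode_cons, rotF_pcode (List.cons_ne_nil _ _), CycList.rot, CycList.one, CycList.zero,
    Nat.add_sub_cancel]

/-! ### `X ^ m`: a counted loop of rotations -/

/-- The body of the rotation loop: rotate the state. [folklore] -/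
noncomputable def rotBody : List Bool → List Bool := rotF ∘ sndPow 1

/-- `rotBody ∈ FP`. [folklore] -/
theorem rotBody_mem_FP : rotBody ∈ FP := comp_mem_FP rotF_mem_FP (sndPow_mem_FP 1)

/-- `rotBody` on a record. [folklore] -/
@[simp] theorem rotBody_apply (x c s : List Bool) : rotBody (boolPair x (boolPair c s)) = rotF s := by
  simp [rotBody]

/-- Growth of the rotation body: two symbols per round. [folklore] -/
theorem length_rotBody_le (z : List Bool) : (rotBody z).length ≤ (sndPow 1 z).length + (2 : Polynomial ℕ).eval (fstF z).length := by
  simpa [rotBody] using length_rotF_le (sndPow 1 z)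

/-- The rotation loop rotates. [folklore] -/
theorem loopModel_rotBody (x : List Bool) : ∀ (k : ℕ) {l : List ℕ}, l ≠ [] →
    loopModel rotBody x k (pcode l) = pcode (CycList.rot^[k] l)
  | 0, l, _ => rfl
  | k + 1, l, hl => by
    have hl' : CycList.rot l ≠ [] := by
      intro h; have := congrArg List.length h; simp at this; exact hl this
    rw [loopModel, rotBody_apply, rotF_pcode hl, loopModel_rotBody x k hl', Function.iterate_succ_apply]

/-- **`xpowG ⟨x, ⟨m, Z⟩⟩ = pcode (xpow r ⟦m⟧)`** (`Z = pcode (zero r)`, canonical `m` with `⟦m⟧ ≤ |x|`): the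
list of `X ^ m`, by `⟦m⟧` rotations of `one r`. [folklore] -/
noncomputable def xpowG : List Bool → List Bool :=
  sndPow 1 ∘ loopX rotBody ∘ fanoutFn fstF (fanoutFn (nthF 1) (oneOf ∘ sndPow 1))

/-- `xpowG ∈ FP`. [cite: AroraBarak2009, §1.3 (bounded loops)] -/
theorem xpowG_mem_FP : xpowG ∈ FP :=
  comp_mem_FP (sndPow_mem_FP 1) (comp_mem_FP (loopX_mem_FP rotBody_mem_FP length_rotBody_le)
    (fanoutFn_mem_FP fstF_mem_FP (fanoutFn_mem_FP (nthF_mem_FP 1) (comp_mem_FP oneOf_mem_FP (sndPow_mem_FP 1)))))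

/-- Value of `xpowG`. [folklore] -/
theorem xpowG_apply (x : List Bool) {m r : ℕ} (hm : m ≤ x.length) (hr : 1 ≤ r) :
    xpowG (boolPair x (boolPair (encodeNat m) (pcode (CycList.zero r)))) = pcode (CycList.xpow r m) := by
  have hne : CycList.one r ≠ [] := by intro h; have := congrArg List.length h; simp [CycList.length_one hr] at this; omega
  simp only [xpowG, Function.comp_apply, fanoutFn_apply, fstF_boolPair, nthF_succ_boolPair, nthF_zero_boolPair,
    sndPow_succ_boolPair, sndPow_zero, sndF_boolPair, oneOf_apply hr]
  rw [loopX_apply _ _ _ hm, loopModel_rotBody x m hne, CycList.xpow]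
  simp

/-! ### The two sides and the test -/

/-- **`rhsG ⟨x, ⟨p, ⟨ρ, Z⟩⟩⟩`**: the list of `X ^ (n mod r) + a`, as
`zipLF axpyG ⟨x, ⟨bin |x|, ⟨1, ⟨xpowG ⟨x, ⟨n mod r, Z⟩⟩, constOfG ⟨a mod n, Z⟩⟩⟩⟩⟩` (`n = ⟦fstF x⟧`, `a = ⟦p⟧`,
`r = ⟦ρ⟧`). [cite: AgrawalKayalSaxena2004, §4 (step 5)] -/
noncomputable def rhsG : List Bool → List Bool :=
  zipLF axpyG ∘ fanoutFn fstF (fanoutFn (lenBinF ∘ fstF) (fanoutFn (fun _ => [true])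
    (fanoutFn (xpowG ∘ fanoutFn fstF (fanoutFn (remFn ∘ fanoutFn (fstF ∘ fstF) (nthF 2)) (sndPow 2)))
      (constOfG ∘ fanoutFn (remFn ∘ fanoutFn (nthF 1) (fstF ∘ fstF)) (sndPow 2)))))

/-- `rhsG ∈ FP`. [folklore] -/
theorem rhsG_mem_FP : rhsG ∈ FP :=
  comp_mem_FP (zipLF_mem_FP axpyG_mem_FP (w := 0) (by norm_num) length_axpyG_le)
    (fanoutFn_mem_FP fstF_mem_FP (fanoutFn_mem_FP (comp_mem_FP lenBinF_mem_FP fstF_mem_FP) (fanoutFn_mem_FP (const_mem_FP _)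
      (fanoutFn_mem_FP (comp_mem_FP xpowG_mem_FP (fanoutFn_mem_FP fstF_mem_FP (fanoutFn_mem_FP
          (comp_mem_FP remFn_mem_FP (fanoutFn_mem_FP (comp_mem_FP fstF_mem_FP fstF_mem_FP) (nthF_mem_FP 2))) (sndPow_mem_FP 2))))
        (comp_mem_FP constOfG_mem_FP (fanoutFn_mem_FP (comp_mem_FP remFn_mem_FP (fanoutFn_mem_FP (nthF_mem_FP 1) (comp_mem_FP fstF_mem_FP fstF_mem_FP))) (sndPow_mem_FP 2)))))))

/-- **Value of `rhsG`**: `pcode (CycList.rhs r n ⟦p⟧)` on `⟨x, ⟨p, ⟨encodeNat r, pcode (zero r)⟩⟩⟩` with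
`n = ⟦fstF x⟧ ≥ 2` and `1 ≤ r ≤ |x|`. [cite: AgrawalKayalSaxena2004, §4 (step 5)] -/
theorem rhsG_apply {x : List Bool} (hx : 2 ≤ bitsToNat (fstF x)) (p : List Bool) {r : ℕ} (hr : 1 ≤ r) (hrx : r ≤ x.length) :
    rhsG (boolPair x (boolPair p (boolPair (encodeNat r) (pcode (CycList.zero r))))) =
      pcode (CycList.rhs r (bitsToNat (fstF x)) (bitsToNat p)) := by
  have hm : bitsToNat (fstF x) % r ≤ x.length := ((Nat.mod_lt _ (by omega)).le).trans hrx
  simp only [rhsG, Function.comp_apply, fanoutFn_apply, fstF_boolPair, nthF_succ_boolPair, nthF_zero_boolPair,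
    sndPow_succ_boolPair, sndPow_zero, sndF_boolPair, lenBinF_apply, remFn_boolPair, bitsToNat_encodeNat,
    xpowG_apply x hm hr, constOfG_apply _ hr]
  rw [pcode, pcode, zipLF_apply _ _ _ le_rfl, List.take_of_length_le (by simp [CycList.length_xpow hr]; omega),
    List.take_of_length_le (by simp; omega), ← encodeNat_one, zipImages_axpyG hx, CycList.rhs, CycList.constP]
  rfl

/-- **`lhsG ⟨x, ⟨p, ⟨ρ, Z⟩⟩⟩ = powG ⟨x, linOfG ⟨a mod n, Z⟩⟩`**: the list computed for `(X + a) ^ n`.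
[cite: AgrawalKayalSaxena2004, §5] -/
noncomputable def lhsG : List Bool → List Bool :=
  powG ∘ fanoutFn fstF (linOfG ∘ fanoutFn (remFn ∘ fanoutFn (nthF 1) (fstF ∘ fstF)) (sndPow 2))

/-- `lhsG ∈ FP`. [folklore] -/
theorem lhsG_mem_FP : lhsG ∈ FP :=
  comp_mem_FP powG_mem_FP (fanoutFn_mem_FP fstF_mem_FP (comp_mem_FP linOfG_mem_FP
    (fanoutFn_mem_FP (comp_mem_FP remFn_mem_FP (fanoutFn_mem_FP (nthF_mem_FP 1) (comp_mem_FP fstF_mem_FP fstF_mem_FP))) (sndPow_mem_FP 2))))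

/-- **Value of `lhsG`**: `pcode (CycList.lhs r n ⟦p⟧)` on `⟨x, ⟨p, ⟨ρ, pcode (zero r)⟩⟩⟩` when `fstF x = encodeNat n`,
`n ≥ 2`, `2 ≤ r ≤ |x|`. [cite: AgrawalKayalSaxena2004, §5] -/
theorem lhsG_apply {x : List Bool} {n : ℕ} (hx : fstF x = encodeNat n) (hn : 2 ≤ n) (p ρ : List Bool) {r : ℕ}
    (hr : 2 ≤ r) (hrx : r ≤ x.length) :
    lhsG (boolPair x (boolPair p (boolPair ρ (pcode (CycList.zero r))))) = pcode (CycList.lhs r n (bitsToNat p)) := by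
  have hx2 : 2 ≤ bitsToNat (fstF x) := by rw [hx, bitsToNat_encodeNat]; exact hn
  have hlin := CycList.length_linear hr n (bitsToNat p)
  simp only [lhsG, Function.comp_apply, fanoutFn_apply, fstF_boolPair, nthF_succ_boolPair, nthF_zero_boolPair,
    sndPow_succ_boolPair, sndPow_zero, sndF_boolPair, remFn_boolPair, hx, bitsToNat_encodeNat, linOfG_apply _ hr]
  rw [show CycList.zero (r - 2) ++ [1, bitsToNat p % n] = CycList.linear r n (bitsToNat p) from rfl,
    powG_apply hx2 (by rw [hlin]; exact hrx) (by rw [hlin]; omega), hlin, hx, bitsToNat_encodeNat,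
    TM2Pass.length_encodeNat_eq_size]
  rfl

/-- **The congruence test** `congrG = eqPairFn ∘ ⟨lhsG, rhsG⟩`: one symbol, `[1]` iff the two canonical
lists agree. [cite: AgrawalKayalSaxena2004, §4 (step 5)] -/
noncomputable def congrG : List Bool → List Bool := eqPairFn ∘ fanoutFn lhsG rhsG

/-- **`congrG ∈ FP`.** [cite: AgrawalKayalSaxena2004, Thm 5.1] -/
theorem congrG_mem_FP : congrG ∈ FP := comp_mem_FP eqPairFn_mem_FP (fanoutFn_mem_FP lhsG_mem_FP rhsG_mem_FP)

/-- `congrG` is one-bit (a value of `eqPairFn`). [folklore] -/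
theorem oneBit_congrG : OneBit congrG := fun z => by
  rw [congrG, Function.comp_apply, fanoutFn_apply, eqPairFn_boolPair]; exact ⟨_, rfl⟩

/-- `pcode` is injective. [folklore] -/
theorem pcode_injective : Function.Injective pcode := by
  intro l₁ l₂ h
  induction l₁ generalizing l₂ with
  | nil =>
    cases l₂ with
    | nil => rfl
    | cons b l₂ => have := congrArg List.length h; simp [pcode_cons] at this; omega
  | cons a l₁ ih =>
    cases l₂ with
    | nil => have := congrArg List.length h; simp [pcode_cons] at this
    | cons b l₂ =>
      rw [pcode_cons, pcode_cons] at h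
      have h1 := congrArg fstF h
      have h2 := congrArg sndF h
      simp only [fstF_boolPair, sndF_boolPair] at h1 h2
      rw [← bitsToNat_encodeNat a, h1, bitsToNat_encodeNat, ih h2]

/-- **Truth of the congruence test.** On `⟨x, ⟨p, ⟨encodeNat r, pcode (zero r)⟩⟩⟩` with `fstF x = encodeNat n`,
`n ≥ 2` and `2 ≤ r ≤ |x|`: `congrG … = [1]` iff `X^r - 1 ∣ (X + a)^n - (X^n + a)` in `(ZMod n)[X]`, `a = ⟦p⟧` —
the congruence `(X + a)^n = X^n + a (mod X^r - 1, n)` of step 5 of the AKS algorithm.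
[cite: AgrawalKayalSaxena2004, §4 (step 5)] -/
theorem congrG_eq_true_iff {x : List Bool} {n : ℕ} (hx : fstF x = encodeNat n) (hn : 2 ≤ n) (p : List Bool) {r : ℕ}
    (hr : 2 ≤ r) (hrx : r ≤ x.length) :
    congrG (boolPair x (boolPair p (boolPair (encodeNat r) (pcode (CycList.zero r))))) = [true] ↔
      (X ^ r - 1 : (ZMod n)[X]) ∣ (X + C (bitsToNat p : ZMod n)) ^ n - (X ^ n + C (bitsToNat p : ZMod n)) := by
  have hx2 : 2 ≤ bitsToNat (fstF x) := by rw [hx, bitsToNat_encodeNat]; exact hn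
  rw [congrG, Function.comp_apply, fanoutFn_apply, eqPairFn_boolPair, lhsG_apply hx hn p _ hr hrx,
    rhsG_apply hx2 p (by omega) hrx, hx, bitsToNat_encodeNat, ← CycList.lhs_eq_rhs_iff hn hr]
  simp only [List.cons.injEq, and_true, decide_eq_true_eq]
  exact ⟨fun h => pcode_injective h, fun h => by rw [h]⟩


/-! ### The condition decided -/

/-- The search bound as a polynomial in `K = |encodeNat n|`: `2 K⁵ + 8` (`AKS.rBound K`).
[cite: AgrawalKayalSaxena2004, Lemma 4.3] -/
noncomputable def rPoly : Polynomial ℕ := 2 * X ^ 5 + 8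

/-- The bound `R n = 2 (Nat.size n)⁵ + 8`. [cite: AgrawalKayalSaxena2004, Lemma 4.3] -/
def rB (n : ℕ) : ℕ := 2 * Nat.size n ^ 5 + 8

/-- `rPoly (|encodeNat n|) = rB n`. [folklore] -/
@[simp] theorem rPoly_eval (n : ℕ) : rPoly.eval (encodeNat n).length = rB n := by
  simp [rPoly, rB, TM2Pass.length_encodeNat_eq_size]

/-- **The condition the machine decides** (see the module docstring). [cite: AgrawalKayalSaxena2004, §4] -/
def AKSCond (n : ℕ) : Prop :=
  2 ≤ n ∧ (∀ d, 2 ≤ d → d ≤ rB n → d < n → ¬ d ∣ n) ∧ (¬ ∃ m b : ℕ, 2 ≤ b ∧ m ^ b = n) ∧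
    ∀ r, 2 ≤ r → r ≤ rB n → ∀ a, 1 ≤ a → a ≤ rB n →
      (X ^ r - 1 : (ZMod n)[X]) ∣ (X + C (a : ZMod n)) ^ n - (X ^ n + C (a : ZMod n))

/-! ### The padded input and the index pieces -/

/-- The padded input `u = ⟨w, 1^R⟩`, `R = rPoly (|w|)`: first field of every loop below (it holds the
numeral and is at least `R` long). [folklore] -/
noncomputable def padU : List Bool → List Bool := fanoutFn id (Plumb.polyFn rPoly)

/-- `padU ∈ FP`. [folklore] -/
theorem padU_mem_FP : padU ∈ FP := fanoutFn_mem_FP OracleCompose.id_mem_FP (Plumb.polyFn_mem_FP _)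

/-- `padU` spelled out. [folklore] -/
@[simp] theorem padU_apply (w : List Bool) : padU w = boolPair w (ones (rPoly.eval w.length)) := by simp [padU]

/-- The yardstick `1^(R-1)` of the loops over `d = i + 2` and `r = i + 2`: the pad without one symbol.
[folklore] -/
noncomputable def yardR : List Bool → List Bool := Plumb.dropFn ∘ fanoutFn (fun _ => [true]) sndF

/-- `yardR ∈ FP`. [folklore] -/
theorem yardR_mem_FP : yardR ∈ FP :=
  comp_mem_FP Plumb.dropFn_mem_FP (fanoutFn_mem_FP (const_mem_FP _) sndF_mem_FP)

/-- `yardR` fits. [folklore] -/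
theorem length_yardR_le (u : List Bool) : (yardR u).length ≤ u.length := by
  have := length_fstF_sndF_le u
  simp [yardR]; omega

/-- `yardR` on the padded input. [folklore] -/
@[simp] theorem yardR_padU (w : List Bool) : (yardR (padU w)).length = rPoly.eval w.length - 1 := by simp [yardR]

/-! ### Small divisors -/

/-- The divisor `d = i + 2` of piece `i`, from `⟨u, 1ⁱ⟩`. [folklore] -/
noncomputable def divOfF : List Bool → List Bool := lenBinF ∘ List.cons true ∘ List.cons true ∘ sndF

/-- **Piece `i` of the small-divisor test** on `⟨⟨w, pad⟩, 1ⁱ⟩`: `[¬ (d < n ∧ d ∣ n)]`, `d = i + 2`, `n = ⟦w⟧`.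
[cite: AgrawalKayalSaxena2004, §4 (steps 3, 4)] -/
noncomputable def divPiece : List Bool → List Bool :=
  notFn (andFn (ltFn ∘ fanoutFn divOfF (fstF ∘ fstF)) (isNilFn ∘ remFn ∘ fanoutFn (fstF ∘ fstF) divOfF))

/-- `divPiece ∈ FP`. [folklore] -/
theorem divPiece_mem_FP : divPiece ∈ FP := by
  have hd : divOfF ∈ FP := comp_mem_FP lenBinF_mem_FP (comp_mem_FP (cons_mem_FP true) (comp_mem_FP (cons_mem_FP true) sndF_mem_FP))
  have hw : (fstF ∘ fstF : List Bool → List Bool) ∈ FP := comp_mem_FP fstF_mem_FP fstF_mem_FP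
  exact notFn_mem_FP (andFn_mem_FP (comp_mem_FP ltFn_mem_FP (fanoutFn_mem_FP hd hw))
    (comp_mem_FP isNilFn_mem_FP (comp_mem_FP remFn_mem_FP (fanoutFn_mem_FP hw hd))))

/-- `divPiece` is one-bit. [folklore] -/
theorem oneBit_divPiece : OneBit divPiece := oneBit_notFn (oneBit_andFn (oneBit_ltFn.comp _) (oneBit_isNilFn.comp _))

/-- Truth of piece `i` on `⟨⟨encodeNat n, pad⟩, 1ⁱ⟩`. [folklore] -/
theorem divPiece_apply (n : ℕ) (pad : List Bool) (i : ℕ) :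
    divPiece (boolPair (boolPair (encodeNat n) pad) (ones i)) = [decide (¬ (i + 2 < n ∧ (i + 2) ∣ n))] := by
  have hd : divOfF (boolPair (boolPair (encodeNat n) pad) (ones i)) = encodeNat (i + 2) := by simp [divOfF, ones]
  have h1 : (ltFn ∘ fanoutFn divOfF (fstF ∘ fstF)) (boolPair (boolPair (encodeNat n) pad) (ones i)) = [decide (i + 2 < n)] := by
    simp [hd]
  have h2 : (isNilFn ∘ remFn ∘ fanoutFn (fstF ∘ fstF) divOfF) (boolPair (boolPair (encodeNat n) pad) (ones i)) =
      [decide ((i + 2) ∣ n)] := by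
    simp only [Function.comp_apply, fanoutFn_apply, fstF_boolPair, hd, remFn_boolPair, bitsToNat_encodeNat, isNilFn,
      encodeNat_eq_nil_iff]
    rw [Bool.decide_congr (Nat.dvd_iff_mod_eq_zero).symm]
  rw [divPiece, notFn_apply (andFn_apply h1 h2)]
  by_cases ha : i + 2 < n <;> by_cases hb : (i + 2) ∣ n <;> simp [ha, hb]

/-- **The small-divisor test** `smallDivG u = [∀ i < R - 1, divPiece ⟨u, 1ⁱ⟩ = [1]]`.
[cite: AgrawalKayalSaxena2004, §4 (steps 3, 4)] -/
noncomputable def smallDivG : List Bool → List Bool := allIdxFn yardR divPiece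

/-- `smallDivG ∈ FP`. [folklore] -/
theorem smallDivG_mem_FP : smallDivG ∈ FP := allIdxFn_mem_FP yardR_mem_FP divPiece_mem_FP oneBit_divPiece

/-- `smallDivG` is one-bit. [folklore] -/
theorem oneBit_smallDivG : OneBit smallDivG := oneBit_allIdxFn oneBit_divPiece length_yardR_le

/-- **Truth of the small-divisor test** on the padded numeral of `n`. [folklore] -/
theorem smallDivG_padU (n : ℕ) :
    smallDivG (padU (encodeNat n)) = [true] ↔ ∀ d, 2 ≤ d → d ≤ rB n → d < n → ¬ d ∣ n := by
  rw [smallDivG, allIdxFn_apply oneBit_divPiece (length_yardR_le _), yardR_padU, rPoly_eval, padU_apply, rPoly_eval]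
  simp only [divPiece_apply, List.cons.injEq, and_true, decide_eq_true_eq, not_and]
  constructor
  · intro h d h2 hR hlt hdvd
    exact h (d - 2) (by omega) (by omega) (by rwa [show d - 2 + 2 = d by omega])
  · intro h i hi hlt hdvd
    exact h (i + 2) (by omega) (by omega) hlt hdvd

/-! ### Perfect powers (step 1), by the detector of `ShorPerfectPowerFP.lean` -/

/-- **`notPerfPowG = notFn (fstF ∘ ShorFP.ppF)`**: the negated flag of the perfect-power detector (which
searches the exponents `k = |m|, …, 2` for `Nat.nthRoot k ⟦m⟧ ^ k = ⟦m⟧`). [cite: AgrawalKayalSaxena2004, §4 (step 1)] -/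
noncomputable def notPerfPowG : List Bool → List Bool := notFn (fstF ∘ ShorFP.ppF)

/-- `notPerfPowG ∈ FP`. [cite: AgrawalKayalSaxena2004, Thm 5.1 (step 1)] -/
theorem notPerfPowG_mem_FP : notPerfPowG ∈ FP := notFn_mem_FP (comp_mem_FP fstF_mem_FP ShorFP.ppF_mem_FP)

/-- `notPerfPowG` is one-bit. [folklore] -/
theorem oneBit_notPerfPowG : OneBit notPerfPowG := oneBit_notFn ShorFP.oneBit_fstF_ppF

/-- Perfect powers `n ≥ 2` through integer roots of exponents `≤ Nat.size n`. [folklore] -/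
theorem exists_pow_eq_iff_isPP {n : ℕ} (hn : 2 ≤ n) :
    (∃ m b : ℕ, 2 ≤ b ∧ m ^ b = n) ↔ ∃ k, k ≤ Nat.size n ∧ ShorFP.IsPP n k := by
  constructor
  · rintro ⟨m, b, hb, rfl⟩
    have hm : 2 ≤ m := by
      by_contra hm
      interval_cases m
      · rw [zero_pow (by omega)] at hn; omega
      · rw [one_pow] at hn; omega
    refine ⟨b, ?_, hb, by rw [Nat.nthRoot_pow (show b ≠ 0 by omega) m]⟩
    by_contra hbs
    have : 2 ^ Nat.size (m ^ b) < m ^ b :=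
      calc 2 ^ Nat.size (m ^ b) < 2 ^ b := Nat.pow_lt_pow_right (by norm_num) (by omega)
        _ ≤ m ^ b := Nat.pow_le_pow_left hm b
    exact absurd (Nat.lt_size_self (m ^ b)) (not_lt.2 this.le)
  · rintro ⟨k, -, hk, h⟩
    exact ⟨Nat.nthRoot k n, k, hk, h⟩

/-- **Truth of the perfect-power test**: for `n ≥ 2`, `notPerfPowG (bin n) = [1]` iff `n` is not `m ^ b` with
`b ≥ 2` (step 1 of the AKS algorithm passes). [cite: AgrawalKayalSaxena2004, §4 (step 1)] -/
theorem notPerfPowG_eq_true_iff {n : ℕ} (hn : 2 ≤ n) :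
    notPerfPowG (encodeNat n) = [true] ↔ ¬ ∃ m b : ℕ, 2 ≤ b ∧ m ^ b = n := by
  have hl : 1 ≤ (encodeNat n).length := by
    rw [TM2Pass.length_encodeNat_eq_size]; exact Nat.size_pos.2 (by omega)
  have h := ShorFP.ppF_apply (encodeNat n) (by rw [bitsToNat_encodeNat]; omega) hl
  have hflag : (fstF ∘ ShorFP.ppF) (encodeNat n) = [decide (∃ k, k ≤ (encodeNat n).length ∧ ShorFP.IsPP n k)] := by
    rw [Function.comp_apply, h, fstF_boolPair, bitsToNat_encodeNat]
  rw [notPerfPowG, notFn_apply hflag, exists_pow_eq_iff_isPP hn, TM2Pass.length_encodeNat_eq_size]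
  simp

/-! ### The congruences, for all `r` and `a` -/

/-- **Piece `j` of the inner loop** on `⟨v, 1ʲ⟩`, `v = ⟨u, 1ⁱ⟩`, `u = ⟨w, pad⟩`: the congruence test
`congrG ⟨u, ⟨bin (j+1), ⟨bin (i+2), pcode (zero (i+2))⟩⟩⟩` for `a = j + 1`, `r = i + 2`.
[cite: AgrawalKayalSaxena2004, §4 (step 5)] -/
noncomputable def congrPiece : List Bool → List Bool :=
  congrG ∘ fanoutFn (fstF ∘ fstF) (fanoutFn (lenBinF ∘ List.cons true ∘ sndF)
    (fanoutFn (lenBinF ∘ List.cons true ∘ List.cons true ∘ sndF ∘ fstF) (zeroListG ∘ List.cons true ∘ List.cons true ∘ sndF ∘ fstF)))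

/-- `congrPiece ∈ FP`. [folklore] -/
theorem congrPiece_mem_FP : congrPiece ∈ FP := by
  have h2 : (List.cons true ∘ List.cons true ∘ sndF ∘ fstF : List Bool → List Bool) ∈ FP :=
    comp_mem_FP (cons_mem_FP true) (comp_mem_FP (cons_mem_FP true) (comp_mem_FP sndF_mem_FP fstF_mem_FP))
  refine comp_mem_FP congrG_mem_FP (fanoutFn_mem_FP (comp_mem_FP fstF_mem_FP fstF_mem_FP)
    (fanoutFn_mem_FP (comp_mem_FP lenBinF_mem_FP (comp_mem_FP (cons_mem_FP true) sndF_mem_FP))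
      (fanoutFn_mem_FP (comp_mem_FP lenBinF_mem_FP h2) (comp_mem_FP zeroListG_mem_FP h2))))

/-- `congrPiece` is one-bit. [folklore] -/
theorem oneBit_congrPiece : OneBit congrPiece := oneBit_congrG.comp _

/-- Truth of piece `j` on `⟨⟨⟨encodeNat n, pad⟩, 1ⁱ⟩, 1ʲ⟩` (`n ≥ 2`, `i + 2 ≤ |encodeNat n| … + |pad|`).
[cite: AgrawalKayalSaxena2004, §4 (step 5)] -/
theorem congrPiece_apply {n : ℕ} (hn : 2 ≤ n) {pad : List Bool} {i : ℕ}
    (hi : i + 2 ≤ (boolPair (encodeNat n) pad).length) (j : ℕ) :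
    congrPiece (boolPair (boolPair (boolPair (encodeNat n) pad) (ones i)) (ones j)) = [true] ↔
      (X ^ (i + 2) - 1 : (ZMod n)[X]) ∣ (X + C ((j + 1 : ℕ) : ZMod n)) ^ n - (X ^ n + C ((j + 1 : ℕ) : ZMod n)) := by
  simp only [congrPiece, Function.comp_apply, fanoutFn_apply, fstF_boolPair, sndF_boolPair, lenBinF_apply,
    List.length_cons, zeroListG_apply]
  rw [show (ones j).length + 1 = j + 1 by simp [ones], show (ones i).length + 1 + 1 = i + 2 by simp [ones],
    congrG_eq_true_iff (fstF_boolPair _ _) hn _ (by omega) hi, bitsToNat_encodeNat]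

/-- **The inner loop** over `a = j + 1`, `j < |pad|`, on `v = ⟨⟨w, pad⟩, 1ⁱ⟩`. [cite: AgrawalKayalSaxena2004, §4 (step 5)] -/
noncomputable def congrRow : List Bool → List Bool := allIdxFn (sndF ∘ fstF) congrPiece

/-- `congrRow ∈ FP`. [folklore] -/
theorem congrRow_mem_FP : congrRow ∈ FP :=
  allIdxFn_mem_FP (comp_mem_FP sndF_mem_FP fstF_mem_FP) congrPiece_mem_FP oneBit_congrPiece

/-- The inner yardstick fits. [folklore] -/
theorem length_sndF_fstF_le (v : List Bool) : ((sndF ∘ fstF) v).length ≤ v.length := by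
  have h1 := length_fstF_sndF_le v
  have h2 := length_fstF_sndF_le (fstF v)
  simp only [Function.comp_apply]; omega

/-- `congrRow` is one-bit. [folklore] -/
theorem oneBit_congrRow : OneBit congrRow := oneBit_allIdxFn oneBit_congrPiece length_sndF_fstF_le

/-- **The outer loop** over `r = i + 2`, `i < R - 1`, on `u = ⟨w, pad⟩`. [cite: AgrawalKayalSaxena2004, §4 (step 5)] -/
noncomputable def congrAllG : List Bool → List Bool := allIdxFn yardR congrRow

/-- `congrAllG ∈ FP`. [folklore] -/
theorem congrAllG_mem_FP : congrAllG ∈ FP := allIdxFn_mem_FP yardR_mem_FP congrRow_mem_FP oneBit_congrRow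

/-- `congrAllG` is one-bit. [folklore] -/
theorem oneBit_congrAllG : OneBit congrAllG := oneBit_allIdxFn oneBit_congrRow length_yardR_le

/-- **Truth of the congruence loops** on the padded numeral of `n ≥ 2`. [cite: AgrawalKayalSaxena2004, §4 (step 5)] -/
theorem congrAllG_padU {n : ℕ} (hn : 2 ≤ n) :
    congrAllG (padU (encodeNat n)) = [true] ↔ ∀ r, 2 ≤ r → r ≤ rB n → ∀ a, 1 ≤ a → a ≤ rB n →
      (X ^ r - 1 : (ZMod n)[X]) ∣ (X + C (a : ZMod n)) ^ n - (X ^ n + C (a : ZMod n)) := by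
  rw [congrAllG, allIdxFn_apply oneBit_congrRow (length_yardR_le _), yardR_padU, rPoly_eval, padU_apply, rPoly_eval]
  simp only [List.cons.injEq, and_true, decide_eq_true_eq]
  have hrow : ∀ i, i < rB n - 1 → (congrRow (boolPair (boolPair (encodeNat n) (ones (rB n))) (ones i)) = [true] ↔
      ∀ j, j < rB n → (X ^ (i + 2) - 1 : (ZMod n)[X]) ∣ (X + C ((j + 1 : ℕ) : ZMod n)) ^ n - (X ^ n + C ((j + 1 : ℕ) : ZMod n))) := by
    intro i hi
    rw [congrRow, allIdxFn_apply oneBit_congrPiece (length_sndF_fstF_le _)]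
    simp only [Function.comp_apply, fstF_boolPair, sndF_boolPair, List.cons.injEq, and_true, decide_eq_true_eq]
    have hlen : (ones (rB n)).length = rB n := by simp [ones]
    rw [hlen]
    refine forall₂_congr fun j _ => ?_
    exact congrPiece_apply hn (by rw [length_boolPair, hlen]; omega) j
  constructor
  · intro h r hr2 hrR a ha1 haR
    have := (hrow (r - 2) (by omega)).1 (h (r - 2) (by omega)) (a - 1) (by omega)
    rwa [show r - 2 + 2 = r by omega, show a - 1 + 1 = a by omega] at this
  · intro h i hi
    exact (hrow i hi).2 fun j hj => h (i + 2) (by omega) (by omega) (j + 1) (by omega) (by omega)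

/-! ### The whole test -/

/-- The canonicity test `[w = encodeNat ⟦w⟧]`. [folklore] -/
noncomputable def canonG : List Bool → List Bool := eqPairFn ∘ fanoutFn id norm

/-- `canonG ∈ FP`. [folklore] -/
theorem canonG_mem_FP : canonG ∈ FP := comp_mem_FP eqPairFn_mem_FP (fanoutFn_mem_FP OracleCompose.id_mem_FP norm_mem_FP)

/-- Value of `canonG`. [folklore] -/
@[simp] theorem canonG_apply (w : List Bool) : canonG w = [decide (w = encodeNat (bitsToNat w))] := by
  simp [canonG, eqPairFn_boolPair, norm_eq_encodeNat]

/-- The three loops ANDed: small divisors, perfect powers, congruences. [cite: AgrawalKayalSaxena2004, §4] -/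
noncomputable def restG : List Bool → List Bool :=
  andFn (smallDivG ∘ padU) (andFn notPerfPowG (congrAllG ∘ padU))

/-- `restG ∈ FP`. [folklore] -/
theorem restG_mem_FP : restG ∈ FP :=
  andFn_mem_FP (comp_mem_FP smallDivG_mem_FP padU_mem_FP) (andFn_mem_FP notPerfPowG_mem_FP (comp_mem_FP congrAllG_mem_FP padU_mem_FP))

/-- `restG` is one-bit. [folklore] -/
theorem oneBit_restG : OneBit restG :=
  oneBit_andFn (oneBit_smallDivG.comp _) (oneBit_andFn oneBit_notPerfPowG (oneBit_congrAllG.comp _))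

/-- A one-bit value whose truth is known is the corresponding `decide`. [folklore] -/
theorem eq_singleton_decide {v : List Bool} {P : Prop} [Decidable P] (h1 : ∃ b : Bool, v = [b]) (h : v = [true] ↔ P) :
    v = [decide P] := by
  obtain ⟨b, hb⟩ := h1
  rw [hb] at h ⊢
  cases b
  · have : ¬ P := fun hp => by simpa using h.2 hp
    rw [decide_eq_false this]
  · rw [decide_eq_true (h.1 rfl)]

/-- Truth of `restG` on the numeral of `n ≥ 2`. [cite: AgrawalKayalSaxena2004, §4] -/
theorem restG_encodeNat {n : ℕ} (hn : 2 ≤ n) :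
    restG (encodeNat n) = [true] ↔ (∀ d, 2 ≤ d → d ≤ rB n → d < n → ¬ d ∣ n) ∧ (¬ ∃ m b : ℕ, 2 ≤ b ∧ m ^ b = n) ∧
      ∀ r, 2 ≤ r → r ≤ rB n → ∀ a, 1 ≤ a → a ≤ rB n →
        (X ^ r - 1 : (ZMod n)[X]) ∣ (X + C (a : ZMod n)) ^ n - (X ^ n + C (a : ZMod n)) := by
  have hsd : (smallDivG ∘ padU) (encodeNat n) = [@decide (∀ d, 2 ≤ d → d ≤ rB n → d < n → ¬ d ∣ n) (Classical.dec _)] :=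
    @eq_singleton_decide _ _ (Classical.dec _) (oneBit_smallDivG.comp padU _) (smallDivG_padU n)
  have hpp := @eq_singleton_decide _ _ (Classical.dec _) (oneBit_notPerfPowG (encodeNat n)) (notPerfPowG_eq_true_iff hn)
  have hcg : (congrAllG ∘ padU) (encodeNat n) = [@decide (∀ r, 2 ≤ r → r ≤ rB n → ∀ a, 1 ≤ a → a ≤ rB n →
      (X ^ r - 1 : (ZMod n)[X]) ∣ (X + C (a : ZMod n)) ^ n - (X ^ n + C (a : ZMod n))) (Classical.dec _)] :=
    @eq_singleton_decide _ _ (Classical.dec _) (oneBit_congrAllG.comp padU _) (congrAllG_padU hn)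
  rw [restG, andFn_apply hsd (andFn_apply hpp hcg)]
  simp only [List.cons.injEq, and_true, Bool.and_eq_true, decide_eq_true_eq]

/-- **The AKS test** `aksFn = [canonical] ∧ ([n ≥ 2] ∧ restG)`. [cite: AgrawalKayalSaxena2004, §4] -/
noncomputable def aksFn : List Bool → List Bool := andFn canonG (andFn valGeTwoFn restG)

/-- **`aksFn ∈ FP`** — the AKS test runs in polynomial time on Mathlib's `FinTM2` (by composition of the
bricks). [cite: AgrawalKayalSaxena2004, Thm 5.1] -/
theorem aksFn_mem_FP : aksFn ∈ FP :=
  andFn_mem_FP canonG_mem_FP (andFn_mem_FP valGeTwoFn_mem_FP restG_mem_FP)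

/-- `aksFn` is one-bit. [folklore] -/
theorem oneBit_aksFn : OneBit aksFn :=
  oneBit_andFn (oneBit_eqPairFn.comp _) (oneBit_andFn oneBit_valGeTwoFn oneBit_restG)

/-- **Truth of the AKS test on a numeral**: `aksFn (encodeNat n) = [1] ↔ AKSCond n`. [cite: AgrawalKayalSaxena2004, §4] -/
theorem aksFn_encodeNat_iff (n : ℕ) : aksFn (encodeNat n) = [true] ↔ AKSCond n := by
  obtain ⟨b', hb'⟩ := oneBit_restG (encodeNat n)
  rw [aksFn, andFn_apply (canonG_apply _) (andFn_apply (b := decide (2 ≤ n)) (by simp [valGeTwoFn]) hb')]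
  simp only [bitsToNat_encodeNat, decide_true, Bool.true_and, List.cons.injEq, and_true, Bool.and_eq_true,
    decide_eq_true_eq, AKSCond]
  by_cases hn : 2 ≤ n
  · have hr := restG_encodeNat hn
    rw [hb'] at hr
    simp only [List.cons.injEq, and_true] at hr
    rw [hr]
  · simp [hn]

/-- **Truth of the AKS test**: `aksFn w = [1]` iff `w` is the canonical numeral of an `n` with `AKSCond n`.
[cite: AgrawalKayalSaxena2004, §4] -/
theorem aksFn_eq_true_iff (w : List Bool) : aksFn w = [true] ↔ ∃ n, w = encodeNat n ∧ AKSCond n := by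
  constructor
  · intro h
    have hw : w = encodeNat (bitsToNat w) := by
      by_contra hw
      obtain ⟨b, hb⟩ := (oneBit_andFn oneBit_valGeTwoFn oneBit_restG) w
      rw [aksFn, andFn_apply (canonG_apply w) hb, decide_eq_false hw] at h
      simp at h
    refine ⟨bitsToNat w, hw, ?_⟩
    rw [hw] at h
    exact (aksFn_encodeNat_iff _).1 h
  · rintro ⟨n, rfl, h⟩
    exact (aksFn_encodeNat_iff n).2 h

end Brick

end Literature.Computability.Complexity
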